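import Mathlib
import HarnessLib
import HarnessLib.Audit
import Summits.Langlands.Statement
import Literature.NumberTheory.Automorphic.CompletedCohomology
import Literature.NumberTheory.Automorphic.Eigenvariety
import Literature.Computability.AlgebraicComplexity.LinSubst
import Literature.NumberTheory.Automorphic.TunnellOctahedralGlobal
import Literature.NumberTheory.Automorphic.BaseChangeUnramifiedLift
import HarnessLib.Audit.Status.Attr

/-!
Route: RuelleTorsionArtinWeight

# Route RuelleTorsionArtinWeight — torsion in p-adic weight families of Kleinian local systems obeys
an Iwasawa shape law; its m-linear term at weight (-1,-1) is the door for Artin points of Bianchi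
completed cohomology

It suffices to show X = X_occ ∧ X_real ∧ J, attacked under the structural law W. X_occ
(ArtinPointsBianchi): for every imaginary quadratic K, every prime p and every irreducible σ : Γ_K →
GL₂(ℚ̄_p) with FINITE image, σ is p-adically automorphic of some tame level — a continuous point of
the big Hecke algebra 𝕋(K^p) of Emerton's completed cohomology of the Bianchi tower (tree, since the
2026-08-15 cone repair: an 𝒪_{ℚ̄_p}-valued point of Spf 𝕋(U^p) of the p-power tower of an S-good
level U ≤ GL₂(𝒪̂_K) — the generic `IsHeckePoint` of
`Literature.NumberTheory.Automorphic.CompletedCohomology` over `ArithmeticQuotient.cohomology` —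
Hansen-associated with σ outside S, `FramedGaloisRep.IsHeckeAssociatedAt`; the fact-free twin of
`TameLevel.IsPadicallyAutomorphic`; torsion eigensystems allowed, no characteristic-0 approximants
demanded). X_real (ArtinWeightRealisation): such a p-adically automorphic Artin σ is weakly
automorphic — a cuspidal π of GL₂(𝔸_K) is Satake–Frobenius compatible with σ at almost all places
(realisation at the singular weight (−1,−1)). J (ImQuadArtinJunction): the GL₂-Artin sector over
imaginary quadratic fields ⇒ the summit. W (TorsionWeightShape, rank 2, the card's K1 made precise):
along every p-adic weight arc λ_m = (a + b p^m, a' + b' p^m) the p-part of each homology group of a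
torsion-free cocompact Kleinian group with coefficients Sym^{k_m} ⊗ Sym^{k'_m}∘c is EVENTUALLY an
exact Iwasawa-shaped function μ₂ p^{2m} + μ₁ p^m + λ m + ν(m mod N). Card realised:
padic-ruelle-torsion-artin-weight (K1 → TorsionWeightShape per degree; K2 → the layer-2 items under
ArtinPointsBianchi; the card's assembly endpoint "occurrence in completed cohomology" →
ArtinPointsBianchi, now typeable).
Lean: `ArtinPointsBianchi ∧ ArtinWeightRealisation ∧ ImQuadArtinJunction`

## Assembly
Pure logic: for K, p, ι, σ as in the target, ArtinPointsBianchi gives a tame level with σ p-adically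
automorphic, ArtinWeightRealisation turns it into a cuspidal π Satake-compatible a.e., which is
StrongArtinImQuad; ImQuadArtinJunction carries it to Langlands. TorsionWeightShape is the structural
law under which ArtinPointsBianchi is attacked (layer 2) and the route's kill switch; it is not a
hypothesis of closes. glue.lean: theorem closes (hocc) (hcls) (hJ) : Langlands (rc 0 in
Sketch.lean).

Rationale: WHY THIS LINE. Where Euler characteristics vanish identically (SL₂(ℂ): defect l₀ = 1) the computable
secondary invariant of an arithmetic 3-manifold is TORSION, and torsion eigensystems carry Galois
determinants (Scholze2015); the card's move is to vary the torsion of Γ\ℍ³ with coefficients V_λ =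
Sym^k ⊗ conj Sym^{k'} p-ADICALLY IN THE WEIGHT λ and read the growth of its p-part along λ_m → λ_*
as an Iwasawa function whose m-linear coefficient counts p-adic eigensystems of exact weight λ_*, at
the Artin weight λ_* = (−1,−1) where no local system exists. This session's analysis reshapes the
card in three places (NOTES.md): (i) over an imaginary quadratic field the tower group G = closure
of Γ in SL₂(O_{K,p})² has finite abelianisation, so the CFKSV 𝔐_H(G)/K₁ formalism the card invokes
is void and Λ(G) has no height-one reflexive ideals but p (arXiv:0710.0624) — the correct "p-adic
Ruelle zeta" is the R-torsion of the Fox complex C_•(Γ) ⊗_{ℤΓ} V_λ as a function of λ, a p-adic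
analogue in the WEIGHT aspect of the Fuglede–Kadison/L²-torsion asymptotics of MarshallMuller2013,
arXiv:1302.0742, BergeronVenkatesh2012 (archimedean) and of Deninger's p-adic Fuglede–Kadison
determinant arXiv:math/0608539 and Kionke's p-adic limits arXiv:1811.00356 (level aspect); (ii)
explicit Lazard/Legendre computations (e.g. ord_p |H₀(Γ(p^r), Sym^k)| = (k+1)r + Σ_{j≤k+1} min(ord_p
j, ord_p(k+2))) show the law needs a quadratic μ-polynomial in p^m and a periodic constant, whence
TorsionWeightShape; (iii) the Euler characteristic T(λ) = |R_{V_λ}(0)| (Fried–Müller,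
arXiv:2005.01450) is BLIND at −ρ = (−1,−1): the four BGG constituents w·λ_m all tend to the
dot-fixed point −ρ with signs (−1)^{l(w)} and cancel to first order — the p-adic mirror of Heilbronn
blindness — so the Artin signal lives in single degrees (H₁ localised at 𝔪), which is how the
layer-2 items are filed. Imported areas: Iwasawa/Hida theory in the weight (doi:10.5802/aif.1434,
doi:10.1215/s0012-7094-93-06914-1, CalegariMazur2008), L²-torsion and p-adic Fuglede–Kadison
determinants, completed cohomology (CalegariEmerton2011, Emerton2006,
HansenUniversalEigenvarieties2017, GeeNewton2020). What it does that prior routes do not: the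
retired BianchiArtinPoints typed occurrence through characteristic-0 regular approximants
(obstructed for even ρ|_K by CalegariMazur2008 Cor. 1.4); here occurrence is the torsion-friendly
continuous-point-of-𝕋(U^p) notion (generic `IsHeckePoint`, re-typed 2026-08-15 off the heavy
`CompletedCohomologyHeckeAlgebraGLn` import cone) and the detector is torsion growth, with a rank-2
crux a refuter can settle by Smith normal forms; negatives index (1 entry, K3 Kuga–Satake)
untouched.

RANKED CRUXES. #0 StrongArtinImQuad (target) — strong Artin (a.e. Satake–Frobenius form, summit
predicate SatakeFrobCompatibleAt) for every irreducible finite-image σ : Γ_K → GL₂(ℚ̄_p), K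
imaginary quadratic, every p and ι — direction (B) of the summit at n = 2, F = K, Hodge–Tate weights
(0,0); contains the restrictions to K of even icosahedral ρ over ℚ. (why it might fail: False only
if (B) fails for GL₂ over an imaginary quadratic field; open beyond solvable images (no parity over
K, no Shimura variety, no weight-one theory); not one insoluble non-base-change instance is known.)
[CalegariMazur2008, Calegari2023, BuzzardGeeLMS2014, AllenKhareThorne2021WeightOne]
#2 TorsionWeightShape (crux) — (card K1, corrected and per degree) L a number field with a ring
endomorphism c and an embedding φ : L → ℂ with φ∘c = conj∘φ; Γ ≤ SL₂(O_L) torsion-free whose image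
under φ is a discrete cocompact subgroup of SL₂(ℂ); p any prime; weights k_m = a + b p^m, k'_m = a'
+ b' p^m with (a,b) ≠ (a',b'). Then for every homological degree i there are a period N+1, rationals
μ₂, μ₁, λ, ν depending only on m mod (N+1), and m₀ with ord_p #H_i(Γ, Sym^{k_m}(O_L²) ⊗
Sym^{k'_m}(O_L²)∘c) = μ₂ p^{2m} + μ₁ p^m + λ m + ν exactly for all m ≥ m₀ (homology is finite by
strong acyclicity, BergeronVenkatesh2012 §4). μ-terms = rank-linear lattice (Lazard) torsion, λ =
order of vanishing at the limit weight of the Jacquet/Hida characteristic series along the arc, ν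
periodic from digit sums. [difficulty: L] (why it might fail: Evaluation on Sym^k of growing rank is
not specialisation along a ℤ_p-line: valuations of Fox-matrix minors may carry ⌊log_p⌋-type or
aperiodic digit-sum terms, μ may depend on the O_L-lattice, and λ may be non-constant if the Hecke
divisor is tangent to the arc.) [MarshallMuller2013, arXiv:1302.0742, arXiv:1811.00356,
arXiv:1204.3298, arXiv:math/0608539, doi:10.5802/aif.1434, doi:10.1007/bf02698833]
#3 ArtinPointsBianchi (crux) — (the card's endpoint "occurrence", = O_K of card
bianchi-artin-points, now typed) for K imaginary quadratic, any prime p and any irreducible σ : Γ_K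
→ GL₂(ℚ̄_p) with finite image there is an S-good tame level 𝒰 of GL₂/K with σ p-adically automorphic
of tame level 𝒰: a continuous ℚ̄_p-point of the completed-cohomology Hecke algebra 𝕋(K^p) with
charpoly σ(Frob_v) = x(P_v) for v ∉ S. Mechanism (layer 2, informal items): at good split p, the
𝔪_σ̄-eigen p-torsion exponent of H₁(Γ₀(𝔫), V_{λ_m}) is unbounded along λ_m → (−1,−1)
(ArtinTorsionExcess) and unbounded exponent is a weight-(−1,−1) point
(WeightPointFromTorsionGrowth), identified with σ by Scholze determinants. [difficulty:
open-problem] (why it might fail: Codimension-one numerology (CalegariMazur2008 §1,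
HansenUniversalEigenvarieties2017 Conj. 1.2.3): a generic weight carries no point; residual
automorphy of σ̄ over K (Serre over K) and big R = 𝕋 in defect one are open, torsion LGC at p
excludes F = K (CaraianiNewton2023 Thm 1.3).) [CalegariMazur2008, HansenUniversalEigenvarieties2017,
Scholze2015, CalegariEmerton2011, GeeNewton2020, CalegariGeraghty2017, CaraianiNewton2023]
#4 ArtinWeightRealisation (crux) — (realisation at the Artin weight over K) a finite-image
irreducible σ : Γ_K → GL₂(ℚ̄_p), K imaginary quadratic, that is p-adically automorphic of some tame
level is Satake–Frobenius compatible a.e. with a cuspidal π of GL₂(𝔸_K) (of Artin type, weight 0 at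
the complex place). Over ℚ the analogue is Buzzard–Taylor/Kisin/Pan classicality at weight one; over
K no q-expansion gluing, no Shimura variety; handles: Sen-theoretic infinitesimal characters of
completed cohomology (Dospinescu–Paškūnas–Schraen type), eigenvariety geometry of Res_{K/ℚ}GL₂,
Rankin–Selberg against the torsion-detected families. [deps: ArtinPointsBianchi] [difficulty:
open-problem] (why it might fail: The NonRegularWeightBarrier over a field with a complex place: no
weight-one theory, no p-adic local–global compatibility at singular weight; even algebraicity of
weight-0 Bianchi eigenvalues is open (Scholze2015 §1); weight 1 → weight 2 over CM unknown
(AllenKhareThorne2021WeightOne).) [AllenKhareThorne2021WeightOne, Scholze2015, Calegari2023,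
HansenUniversalEigenvarieties2017, Literature.Barriers.Langlands.NonRegularWeightBarrier]
#9 ImQuadArtinJunction (support) — the rest of the summit: the GL₂ Artin sector over imaginary
quadratic fields (a.e. form) ⇒ Langlands (upgrade a.e. to Corresponds by LGC + strong multiplicity
one; quadratic descent K → ℚ for even ρ; all other n, F, weights and direction (A)). Not this
route's business; filed so that closes ends in the summit constant; shared junction for every
imaginary-quadratic Artin card. [difficulty: open-problem] [BuzzardGeeLMS2014,
FontaineMazurGeometric1995, ArthurClozelAMS120]

TWO-LAYER PLAN. ArtinPointsBianchi ⇐ ArtinTorsionExcess → WeightPointFromTorsionGrowth →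
ArtinPointsBianchi (k = 2; both children filed informal at open, typed once the definition request
"Hecke module structure on H_*(Γ₀(𝔫) ≤ GL₂(O_K), V_λ(O)) with U_p" lands). TorsionWeightShape ⇐
(degree-0/Lazard part: H_i(G, Sym^k ⊗ Sym^{k'}) for uniform G ≤ SL₂(ℤ_p)², provable) → (ordinary
part: Hida control over Λ_W = O[[T₁,T₂]], doi:10.5802/aif.1434) → (finite/infinite slope remainder)
— foreseen split by slope, not filed.

KILL CRITERIA. TorsionWeightShape refuted by a certified computation (one torsion-free cocompact
arithmetic Kleinian Γ, p = 3 or 5, k' = 0, k_m = a + b p^m, Smith forms of the Fox matrices for m ≤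
4 incompatible with every (N ≤ 3, μ₂, μ₁, λ, ν)) closes the route refuted:TorsionWeightShape — the
torsion detector is then noise and the line has no mechanism. ArtinPointsBianchi refuted (an Artin σ
provably absent from 𝕋(K^p)) refutes Fontaine–Mazur–Emerton occurrence and kills this and every
completed-cohomology route over K. ArtinWeightRealisation is shared fate with the whole
Artin-over-CM sector (pivot: none; it is the wall). A conforming re-open of bianchi-artin-points
proving ArtinPointsBianchi by Galois-side dévissage moots layer 2 here but not the route.

NOT DECOMPOSED YET. The 𝔪-localised, single-degree form of the law (K2's dictionary: λ-coefficient
of H₁ at 𝔪 = number of weight-λ_* points of 𝕋(K^p)_𝔪 with multiplicity) and the Artin excess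
inequality are informal layer-2 items until Hecke operators on integral weight-λ homology of
Bianchi/Kleinian groups exist in the tree (definition request filed). The slope decomposition of
TorsionWeightShape (Lazard part / Hida-ordinary part / positive slope), the dependence of μ on the
O_L-lattice, torsion Jacquet–Langlands between Γ_B and Bianchi levels (CalegariVenkatesh2019), and
quadratic descent K → ℚ are deliberately not items.

CHEAPEST FALSIFIER. Take a torsion-free cocompact arithmetic Kleinian group with a short
presentation (a torsion-free finite-index subgroup of a small-covolume quaternionic Γ_B over ℚ(i),
or a closed census manifold with integral traces, e.g. from SnapPy/Magma tables), p = 5 (split in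
ℚ(i)), k' = 0, k_m = 1 + 4·5^m (m = 0..3: ranks 6, 22, 102, 502): Fox calculus gives the boundary
matrices over ℤ[Γ]; evaluate on Sym^{k_m}(O_L²) ⊗ ℤ_5, Smith normal form, record ord_5 #H_0, #H_1,
#H_2; fit μ₂ = 0 (b' = 0), μ₁, λ, ν with N ≤ 2 on m ≤ 2 and test m = 3. Not run here (hub is
compute-free; kit not in this seat's payload). Second run toward (−1,−1): (k,k') = (−1+2·3^{m+1},
−1+2·3^{m+2}) at p = 3 on a level where a tetrahedral σ_K exists vs one where none does (layer-2
prediction: λ differs by ≥ 1 in H₁).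

NUMBERS. l₀(SL₂(ℂ)) = 1, q₀ = 1; weight space of Res_{K/ℚ}GL₂ has dimension 4 (3 modulo twists),
Bianchi eigenvariety components through non-critical regular points have dimension exactly 3 = dim W
− 1 (HansenUniversalEigenvarieties2017 Thm 1.1.5), so a generic weight fibre is empty; ord_p
|H₀(Γ(p^r) ≤ SL₂(ℤ_p), Sym^k ℤ_p²)| = (k+1) r + Σ_{j=1}^{k+1} min(ord_p j, ord_p(k+2)) (this
session), giving μ₁ = b(r + (1 − p^{−ord_p(a+2)})/(p−1)) along k_m = a + b p^m when a ≠ −2 and an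
extra λ = −1 at a = −2; archimedean comparison: log T(λ) ~ c·vol·deg growth (MarshallMuller2013 Thm
1.3, arXiv:1302.0742). NON-VACUITY OF TorsionWeightShape (refuter query 2026-08-15): instances of
its hypotheses exist — e.g. Γ a torsion-free finite-index subgroup (Selberg) of the norm-one units
of a maximal order in a division quaternion algebra B over a number field F with exactly one complex
place, ramified at every real place (cocompact arithmetic Kleinian groups,
doi:10.1007/978-1-4757-6720-9 Thm. 8.2.3 and §8.2; the Weeks manifold's class: F the cubic field of
discriminant −23, B ramified at the real place and at the prime of norm 5), conjugated into SL₂(O_L)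
for L ⊂ B a CM maximal subfield enlarged to make the order's lattice free (Hilbert class field;
Steinitz), with c = complex conjugation of L and φ the embedding above the complex place of F;
Bianchi groups SL₂(O_K) themselves are excluded (not cocompact) by design.

DEFINITION REQUESTS. D1 (for the layer-2 items): Hecke operators T_v, U_𝔭 on the integral weight-λ
homology H_*(Γ₀(𝔫), Sym^k(O²) ⊗ Sym^{k'}(O²)∘c) of congruence subgroups of GL₂(O_K), K imaginary
quadratic ("coefficients at p" model compatible with TwistedQuotient.cohomology rationally), and the
𝔪-adic torsion exponent of a Hecke module — topic Literature/NumberTheory/Automorphic. Cite-facts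
wanted as hypotheses later: Hida's control theorem and Λ_W-torsion of the nearly ordinary Hecke
algebra over imaginary quadratic fields (doi:10.5802/aif.1434, doi:10.1215/s0012-7094-93-06914-1);
Scholze2015 Thm V.4.1 for Bianchi torsion (tree: Scholze2015_galoisRep_of_modPEigensystem). LIBRARY
NOTE (cone repair 2026-08-15):
`Literature.NumberTheory.Automorphic.CompletedCohomologyHeckeAlgebraGLn` imports
`GLnCuspidalSpectrumProofs` (151-module cone carrying 41 unproved named facts: multiplicity one,
Jacquet–Langlands, Hecke L-functions, …) although the compactness witness it uses,
`isCompact_glFiniteIntegralLevel_holds`, lives in the light `GLnAdelicStructureProofs`; until a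
librarian trims that import, routes should type p-adic occurrence over
`CompletedCohomology`/`CompletedCohomologyPoints` + `Eigenvariety` as done here, and
`TameLevel.IsPadicallyAutomorphic` can be re-adopted afterwards by a 1:1 restate.

Novelty: Searches (2026-08-15; local searchd/vsearch rc 75 all session, zbMATH reachable, galaxy reachable):
lit search --source zbmath "torsion cohomology hyperbolic 3-manifolds weight" (1: Müller–Pfaff
arXiv:1302.0742), "Marshall Mueller torsion arithmetic hyperbolic 3-manifolds" (2:
MarshallMuller2013, arXiv:1302.0742), "p-adic Fuglede-Kadison determinant" (2: Deninger
arXiv:math/0608539), "Kionke p-adic Betti numbers" (4: arXiv:1811.00356, arXiv:1305.5057,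
arXiv:1709.00769, arXiv:2003.10756), "Hida p-ordinary cohomology groups SL(2) number fields" (2:
doi:10.1215/s0012-7094-93-06914-1, doi:10.24033/bsmf.2266), "Hida p-adic ordinary Hecke algebras for
GL(2)" (4: doi:10.5802/aif.1434 …), "nearly ordinary Galois representations imaginary quadratic
even" (1: CalegariMazur2008), "Ruelle zeta function twisted torsion hyperbolic" (8: Müller 2021,
arXiv:2005.01450, Spilioti arXiv:2004.13474, …), "completed cohomology Bianchi torsion Iwasawa" (0),
"p-adic analytic twisted torsion group homology polynomial representations" (0), "Ardakov Wei Zhang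
reflexive ideals Iwasawa algebras" (2: arXiv:0710.0624, arXiv:0710.0635), "Totaro Euler
characteristics for p-adic Lie groups" (2); lit galaxy search "p-adic Reidemeister torsion" --star
all (0), "p-adic Fuglede" --star all (1: Silverman GTM 241 bibliography), "torsion in the cohomology
of arithmetic hyperbolic 3-manifolds" --star pdf (3: Lê arXiv:1412.7758, Fedosova arXiv:1601.07873,
Matz–Müller), "torsion homology growth in the weight aspect" --s  [refs: 10.1215/s0012-7094-93-06914-1, 10.24033/bsmf.2266, 10.5802/aif.1434, 1302.0742, math/0608539, 1811.00356, 1305.5057, 1709.00769, 2003.10756, 2005.01450, 2004.13474, 0710.0624, 0710.0635, 1412.7758, 1601.07873, 1204.3298, doi:10.1215/s0012-7094-93-06914-1, doi:10.24033/bsmf.2266, doi:10.5802/aif.1434, MarshallMuller2013, CalegariMazur2008]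

Barriers (technique_class: torsion-weight-law completed-cohomology hida-theory): - technique_class: torsion-weight-law completed-cohomology hida-theory
- Literature.Barriers.Langlands.NonRegularWeightBarrier: met head-on by ArtinWeightRealisation and
NOT evaded (it is the wall for the whole Artin-over-CM sector); evaded by
TorsionWeightShape/ArtinPointsBianchi in the one way the barrier text leaves open — the singular
weight (−1,−1) is never given a local system: it is approached p-adically through strongly acyclic
regular weights whose torsion eigensystems have Galois determinants (Scholze2015), and what is
detected is an m-linear growth coefficient, not an eigenclass.
- Literature.Barriers.Langlands.TaylorWilesNumericalCoincidence: defect l₀ = 1 is the REASON the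
invariant is secondary (torsion) rather than an Euler characteristic; no patching in ranks 2–4; the
layer-2 identification of the detected point with σ would meet big R = 𝕋 in defect one and does not
evade it (the bet is multiplicity counting at 𝔪_σ̄ instead of R = 𝕋).
- Literature.Barriers.Langlands.ShimuraVarietyRealizationBarrier: not engaged — Kleinian/Bianchi
quotients only; Galois representations for torsion over K are Scholze's theorem; the barrier
reappears only inside ImQuadArtinJunction (descent and other fields), which is not this route's
business.
- Literature.Barriers.Langlands.ModPLanglandsGL2BeyondQp: sidestepped by working at p split in K
(K_v = ℚ_p) in layer 2; ArtinPointsBianchi is stated for all p and at inert p the bet is that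
occurrence needs no p-adic local Langlands, only

History (route lifecycle, newest last):
- 2026-08-15T16:46:17Z · rev 1: restated ArtinPointsBianchi (stmt-Langlands-10837), ArtinWeightRealisation (stmt-Langlands-10838) — cone repair: imports CompletedCohomologyGL -> CompletedCohomology+Eigenvariety; ArtinPointsBianchi, ArtinWeightRealisation re-typed over generic IsHeckePoint + (planner-rrepair-Langlands-RuelleTorsionArtinWe-be271b09-0)
- 2026-08-16T16:42:18Z · AUTO-CRUX (backfill): ImQuadArtinJunction — hypotheses of the deciding theorem that nothing in the route derives are cruxes (operator:999:1813213)
- 2026-08-25T07:24:21Z · DORMANT — reconciler: no traction for 7.5 d (last activity item-evidence-added at 2026-08-17T19:05:05Z); parked, not closed — `ledger route dormant route-Langlands-Ruelle (operator:999:768587)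
- 2026-08-29T00:29:28Z · REACTIVATED — reconciler: reactivated — activity statement-checked at 2026-08-28T21:32:13Z after parking at 2026-08-25T07:24:21Z (operator:999:56392)

sub-problem: Langlands · status: open · opened planner-plancard-Langlands-Langlands-padic-ru-9bd1e66b-0 2026-08-15T16:25:03Z · rev 5 · ledger route-Langlands-RuelleTorsionArtinWeight
GENERATED by the gate from the ledger (D-0016/17). Provers cite these decls: `theorem foo : Summit.Langlands.Langlands.Theses.RuelleTorsionArtinWeight.<Decl> := …` in Summits/Langlands/Langlands/Theorems/<Name>.lean.
-/

namespace Summit.Langlands.Langlands.Theses.RuelleTorsionArtinWeight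

open scoped BigOperators Topology Manifold Classical MeasureTheory ProbabilityTheory Matrix InnerProductSpace ComplexConjugate ContinuousMap
open Filter Set Function TopologicalSpace MeasureTheory

attribute [summit_statement] _root_.Langlands

/-- item stmt-Langlands-10835 · target · rank 0 · open · by planner
why it might fail: False only if direction (B) fails for GL₂/K, K imaginary quadratic, HT weights (0,0); provably nothing reaches past solvable images (Langlands–Tunnell + base change): no oddness, no Shimura variety, cohomology blind at weight (−1,−1); no insoluble non-base-change case over any K (Calegari2023 §12).
sources: CalegariMazur2008, Calegari2023, BuzzardGeeLMS2014, AllenKhareThorne2021WeightOne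
[target] strong Artin (a.e. Satake–Frobenius form, summit predicate SatakeFrobCompatibleAt) for
every irreducible finite-image σ : Γ_K → GL₂(ℚ̄_p), K imaginary quadratic, every p and ι — direction
(B) of the summit at n = 2, F = K, Hodge–Tate weights (0,0); contains the restrictions to K of even
icosahedral ρ over ℚ. -/
@[route_item "route-Langlands-RuelleTorsionArtinWeight"]
def StrongArtinImQuad : Prop :=
  ∀ (K : Type) [Field K] [NumberField K], NumberField.IsTotallyComplex K → Module.finrank ℚ K = 2 → ∀ (p : ℕ) [Fact p.Prime] (ι : PadicAlgCl p ≃+* ℂ) (σ : Literature.NumberTheory.GaloisRepresentations.FramedGaloisRep K (PadicAlgCl p) 2), Finite σ.toMonoidHom.range → σ.toGaloisRep.IsIrreducible → ∃ (hcpt : Literature.NumberTheory.Automorphic.isCompact_glFiniteIntegralLevel 2 K) (π : Literature.NumberTheory.Automorphic.CuspidalAutomorphicRepData 2 K hcpt), ∀ᶠ w : IsDedekindDomain.HeightOneSpectrum (NumberField.RingOfIntegers K) in Filter.cofinite, SatakeFrobCompatibleAt ι π.1 σ w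

/-- item stmt-Langlands-10836 · crux · rank 2 · open · by planner
why it might fail: Exactness ∀ i, p, Γ (non-arithmetic Γ too: λ has no Hecke meaning) needs Weierstrass-type control of elementary divisors of Λ(G)-matrices on Sym^{a+bp^m}, G ≤ SL₂(ℤ_p)² open, Λ(G) non-commutative (structure only mod pseudo-null, arXiv:0710.0624); integral Lazard fails at small p (arXiv:0904.3863).
sources: MarshallMuller2013, arXiv:1302.0742, BergeronVenkatesh2012, doi:10.1215/s0012-7094-93-06914-1, doi:10.5802/aif.1434, arXiv:0904.3863
[crux] (card K1, corrected and per degree) L a number field with a ring endomorphism c and an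
embedding φ : L → ℂ with φ∘c = conj∘φ; Γ ≤ SL₂(O_L) torsion-free whose image under φ is a discrete
cocompact subgroup of SL₂(ℂ); p any prime; weights k_m = a + b p^m, k'_m = a' + b' p^m with (a,b) ≠
(a',b'). Then for every homological degree i there are a period N+1, rationals μ₂, μ₁, λ, ν
depending only on m mod (N+1), and m₀ with ord_p #H_i(Γ, Sym^{k_m}(O_L²) ⊗ Sym^{k'_m}(O_L²)∘c) = μ₂
p^{2m} + μ₁ p^m + λ m + ν exactly for all m ≥ m₀ (homology is finite by strong acyclicity,
BergeronVenkatesh2012 §4). μ-terms = rank-linear lattice (Lazard) torsion, λ = order of vanishing at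
the limit weight of the Jacquet/Hida characteristic series along the arc, ν periodic from digit
sums. [difficulty: L] -/
@[route_item "route-Langlands-RuelleTorsionArtinWeight"]
def TorsionWeightShape : Prop :=
  ∀ (L : Type) [Field L] [NumberField L] (c : L →+* L) (φ : L →+* ℂ), (∀ x : L, φ (c x) = starRingEnd ℂ (φ x)) → ∀ (Γ : Subgroup (Matrix.SpecialLinearGroup (Fin 2) (NumberField.RingOfIntegers L))), (∀ γ : Γ, IsOfFinOrder γ → γ = 1) → DiscreteTopology (Γ.map (Matrix.SpecialLinearGroup.map (φ.comp (algebraMap (NumberField.RingOfIntegers L) L)))) → CompactSpace (Matrix.SpecialLinearGroup (Fin 2) ℂ ⧸ Γ.map (Matrix.SpecialLinearGroup.map (φ.comp (algebraMap (NumberField.RingOfIntegers L) L)))) → ∀ (p : ℕ) [Fact p.Prime] (a a' : ℤ) (b b' : ℕ), (a, b) ≠ (a', b') → ∀ i : ℕ, ∃ (N : ℕ) (μ₂ μ₁ lam ν : ℕ → ℚ) (m₀ : ℕ), ∀ m : ℕ, m₀ ≤ m → (padicValNat p (Nat.card (groupHomology (CategoryTheory.MonoidalCategoryStruct.tensorObj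 (Rep.of ((Literature.Computability.AlgebraicComplexity.formRep (Fin 2) (NumberField.RingOfIntegers L) (a + b * (p : ℤ) ^ m).toNat).comp (Matrix.SpecialLinearGroup.toGL.comp Γ.subtype))) (Rep.of ((Literature.Computability.AlgebraicComplexity.formRep (Fin 2) (NumberField.RingOfIntegers L) (a' + b' * (p : ℤ) ^ m).toNat).comp (Matrix.SpecialLinearGroup.toGL.comp ((Matrix.SpecialLinearGroup.map (NumberField.RingOfIntegers.mapRingHom c)).comp Γ.subtype))))) i)) : ℚ) = μ₂ (m % (N + 1)) * (p : ℚ) ^ (2 * m) + μ₁ (m % (N + 1)) * (p : ℚ) ^ m + lam (m % (N + 1)) * m + ν (m % (N + 1))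

-- earlier ArtinPointsBianchi (stmt-Langlands-10837, replaced 2026-08-15T16:46:17Z -> stmt-Langlands-11056): retired by None — ∀ (K : Type) [Field K] [NumberField K], NumberField.IsTotallyComplex K → Module.finrank ℚ K = 2 → ∀ (p : ℕ) [Fact p.Prime] (σ : Literature.NumberTheory.GaloisRepresentations.FramedGaloisRep K (PadicAlgCl p) 2), Finite σ.toMonoidHom.range → σ.toGaloisRep.IsIrreducible → ∃ 𝒰 : 
/-- item stmt-Langlands-11056 · crux · rank 3 · open · by planner
why it might fail: Both pillars open over K: residual modularity of σ̄ (Serre/K: numerics only, Torrey JNT 2012) and big R = 𝕋(K^p)_𝔪 in defect l₀ = 1 (conditional only, GeeNewton2020); generic weights carry no point (CalegariMazur2008 §1, Hansen Conj. 1.2.3); torsion LGC excludes F = K (CaraianiNewton2023 Rem 1.3.1).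
sources: CalegariMazur2008, HansenUniversalEigenvarieties2017, Scholze2015, CalegariEmerton2011, GeeNewton2020, CalegariGeraghty2017
[crux] (the card's endpoint "occurrence", = O_K of card bianchi-artin-points; re-typed 2026-08-15
(cone repair) over the fact-free generic completed-cohomology modules instead of
`TameLevel.IsPadicallyAutomorphic`) for K imaginary quadratic, any prime p and any irreducible σ :
Γ_K → GL₂(ℚ̄_p) with finite image, σ is p-adically automorphic of some S-good tame level: there are
a finite S ⊇ {v ∣ p}, an open U ≤ GL₂(𝒪̂_K) containing {g ∈ GL₂(𝒪̂_K) : g_v = 1 for v ∈ S} (i.e. U =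
U_S·∏_{v∉S} GL₂(𝒪_v)), uniformisers ϖ_v and an 𝒪_{ℚ̄_p}-valued eigensystem a : (v ∉ S, i ∈ {1,2}) ↦
a_{v,i} which (i) is a point of Spf 𝕋(U^p) — generic `IsHeckePoint` of `CompletedCohomology`: for
every t the assignment T_{v,i} ↦ a_{v,i} extends to an 𝒪-algebra map, continuous (factoring through
finitely many pieces), from the big Hecke algebra of the p-power tower U_r = U ∩ Γ(p^r) acting on
⊕_{i,r,t'} H^i(X_{U_r}, 𝒪/p^{t'}) (X_U Scholze's stacky quotient, H^i = group cohomology of GL₂(K),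
`ArithmeticQuotient.cohomology`; T_{v,i} = [U_r diag(ϖ_v ×i, 1 ×(2−i)) U_r] acting by
`ArithmeticQuotient.heckeEnd`, (T_g f)(xU) = Σ_{hU ⊆ UgU} f(xhU)) to 𝒪/p^t — and (ii) is associated
with σ at every v ∉ S in Hansen's norma -/
@[route_item "route-Langlands-RuelleTorsionArtinWeight", crux]
def ArtinPointsBianchi : Prop :=
  ∀ (K : Type) [Field K] [NumberField K], NumberField.IsTotallyComplex K → Module.finrank ℚ K = 2 → ∀ (p : ℕ) [Fact p.Prime] (σ : Literature.NumberTheory.GaloisRepresentations.FramedGaloisRep K (PadicAlgCl p) 2), Finite σ.toMonoidHom.range → σ.toGaloisRep.IsIrreducible → ∃ (S : Finset (IsDedekindDomain.HeightOneSpectrum (NumberField.RingOfIntegers K))) (U : Subgroup (GL (Fin 2) (IsDedekindDomain.FiniteAdeleRing (NumberField.RingOfIntegers K) K))) (ϖ : ∀ v : IsDedekindDomain.HeightOneSpectrum (NumberField.RingOfIntegers K), (v.adicCompletion K)ˣ) (a : {v : IsDedekindDomain.HeightOneSpectrum (NumberField.RingOfIntegers K) // v ∉ S} → ℕ → (Valued.v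 (R := PadicAlgCl p)).valuationSubring), (∀ v : IsDedekindDomain.HeightOneSpectrum (NumberField.RingOfIntegers K), ((p : ℕ) : NumberField.RingOfIntegers K) ∈ v.asIdeal → v ∈ S) ∧ IsOpen (U : Set (GL (Fin 2) (IsDedekindDomain.FiniteAdeleRing (NumberField.RingOfIntegers K) K))) ∧ U ≤ Literature.NumberTheory.Automorphic.glFiniteIntegralLevel 2 K ∧ (∀ g ∈ Literature.NumberTheory.Automorphic.glFiniteIntegralLevel 2 K, (∀ v ∈ S, ∀ i j : Fin 2, ((g : Matrix (Fin 2) (Fin 2) (IsDedekindDomain.FiniteAdeleRing (NumberField.RingOfIntegers K) K)) i j) v = (1 : Matrix (Fin 2) (Fin 2) (v.adicCompletion K)) i j) → g ∈ U) ∧ (∀ v : IsDedekindDomain.HeightOneSpectrum (NumberField.RingOfIntegers K), Valued.v ((ϖ v : (v.adicCompletion K)ˣ) : v.adicCompletion K) = WithZero.exp (-1 : ℤ)) ∧ Literature.NumberTheory.Automorphic.IsHeckePoint (Matrix.GeneralLinearGroup.map (n := Fin 2) (algebraMap K (IsDedekindDomain.FiniteAdeleRing (NumberField.RingOfIntegers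 K) K))) (Literature.NumberTheory.Automorphic.LevelTower.ofSeq U (fun r : ℕ => (Literature.NumberTheory.Automorphic.principalCongruenceLevel 2 K (Ideal.span {((p : ℕ) : NumberField.RingOfIntegers K)} ^ r)).map (Literature.NumberTheory.Automorphic.GLn.sndHom 2 K))) ((p : ℕ) : (Valued.v (R := PadicAlgCl p)).valuationSubring) (fun j : {v : IsDedekindDomain.HeightOneSpectrum (NumberField.RingOfIntegers K) // v ∉ S} × Fin 2 => Literature.NumberTheory.Automorphic.GLn.sndHom 2 K (Literature.NumberTheory.Automorphic.heckeDiagAt 2 K j.1.1 (ϖ j.1.1) (j.2.val + 1))) (fun j => a j.1 (j.2.val + 1)) ∧ ∀ (v : IsDedekindDomain.HeightOneSpectrum (NumberField.RingOfIntegers K)) (hv : v ∉ S), σ.IsHeckeAssociatedAt v (fun i : ℕ => if i = 0 then (1 : PadicAlgCl p) else ((a ⟨v, hv⟩ i : (Valued.v (R := PadicAlgCl p)).valuationSubring) : PadicAlgCl p))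

-- earlier ArtinWeightRealisation (stmt-Langlands-10838, replaced 2026-08-15T16:46:17Z -> stmt-Langlands-11057): retired by None — ∀ (K : Type) [Field K] [NumberField K], NumberField.IsTotallyComplex K → Module.finrank ℚ K = 2 → ∀ (p : ℕ) [Fact p.Prime] (ι : PadicAlgCl p ≃+* ℂ) (σ : Literature.NumberTheory.GaloisRepresentations.FramedGaloisRep K (PadicAlgCl p) 2), Finite σ.toMonoidHom.range → σ.toGal
/-- item stmt-Langlands-11057 · crux · rank 4 · open · by planner
why it might fail: Implied by the target (false only if strong Artin/K fails); as a step: classicality at the singular weight over a field with a complex place — no Shimura variety, no q-expansion, companion-form or overconvergent⇒classical criterion (Pan arXiv:2209.06366: ℚ only); algebraicity open (Scholze2015 §1).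
sources: Scholze2015, Calegari2023, AllenKhareThorne2021WeightOne, HansenUniversalEigenvarieties2017, arXiv:2209.06366, Literature.Barriers.Langlands.NonRegularWeightBarrier
[crux] (realisation at the Artin weight over K; hypothesis re-typed 2026-08-15 (cone repair) = the
occurrence predicate of ArtinPointsBianchi verbatim) a finite-image irreducible σ : Γ_K → GL₂(ℚ̄_p),
K imaginary quadratic, that is p-adically automorphic of some S-good tame level U (an
𝒪_{ℚ̄_p}-valued point of Spf 𝕋(U^p) of the p-power tower, generic `IsHeckePoint`, Hansen-associated
with σ at every v ∉ S, `FramedGaloisRep.IsHeckeAssociatedAt`) is Satake–Frobenius compatible a.e.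
with a cuspidal π of GL₂(𝔸_K) (of Artin type, weight 0 at the complex place). Over ℚ the analogue is
Buzzard–Taylor/Kisin/Pan classicality at weight one; over K no q-expansion gluing, no Shimura
variety; handles: Sen-theoretic infinitesimal characters of completed cohomology
(Dospinescu–Paškūnas–Schraen type), eigenvariety geometry of Res_{K/ℚ}GL₂, Rankin–Selberg against
the torsion-detected families. [deps: ArtinPointsBianchi] [difficulty: open-problem] -/
@[route_item "route-Langlands-RuelleTorsionArtinWeight", crux]
def ArtinWeightRealisation : Prop :=
  ∀ (K : Type) [Field K] [NumberField K], NumberField.IsTotallyComplex K → Module.finrank ℚ K = 2 → ∀ (p : ℕ) [Fact p.Prime] (ι : PadicAlgCl p ≃+* ℂ) (σ : Literature.NumberTheory.GaloisRepresentations.FramedGaloisRep K (PadicAlgCl p) 2), Finite σ.toMonoidHom.range → σ.toGaloisRep.IsIrreducible → (∃ (S : Finset (IsDedekindDomain.HeightOneSpectrum (NumberField.RingOfIntegers K))) (U : Subgroup (GL (Fin 2) (IsDedekindDomain.FiniteAdeleRing (NumberField.RingOfIntegers K) K))) (ϖ : ∀ v : IsDedekindDomain.HeightOneSpectrum (NumberField.RingOfIntegers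 K), (v.adicCompletion K)ˣ) (a : {v : IsDedekindDomain.HeightOneSpectrum (NumberField.RingOfIntegers K) // v ∉ S} → ℕ → (Valued.v (R := PadicAlgCl p)).valuationSubring), (∀ v : IsDedekindDomain.HeightOneSpectrum (NumberField.RingOfIntegers K), ((p : ℕ) : NumberField.RingOfIntegers K) ∈ v.asIdeal → v ∈ S) ∧ IsOpen (U : Set (GL (Fin 2) (IsDedekindDomain.FiniteAdeleRing (NumberField.RingOfIntegers K) K))) ∧ U ≤ Literature.NumberTheory.Automorphic.glFiniteIntegralLevel 2 K ∧ (∀ g ∈ Literature.NumberTheory.Automorphic.glFiniteIntegralLevel 2 K, (∀ v ∈ S, ∀ i j : Fin 2, ((g : Matrix (Fin 2) (Fin 2) (IsDedekindDomain.FiniteAdeleRing (NumberField.RingOfIntegers K) K)) i j) v = (1 : Matrix (Fin 2) (Fin 2) (v.adicCompletion K)) i j) → g ∈ U) ∧ (∀ v : IsDedekindDomain.HeightOneSpectrum (NumberField.RingOfIntegers K), Valued.v ((ϖ v : (v.adicCompletion K)ˣ) : v.adicCompletion K) = WithZero.exp (-1 : ℤ)) ∧ Literature.NumberTheory.Automorphic.IsHeckePoint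 (Matrix.GeneralLinearGroup.map (n := Fin 2) (algebraMap K (IsDedekindDomain.FiniteAdeleRing (NumberField.RingOfIntegers K) K))) (Literature.NumberTheory.Automorphic.LevelTower.ofSeq U (fun r : ℕ => (Literature.NumberTheory.Automorphic.principalCongruenceLevel 2 K (Ideal.span {((p : ℕ) : NumberField.RingOfIntegers K)} ^ r)).map (Literature.NumberTheory.Automorphic.GLn.sndHom 2 K))) ((p : ℕ) : (Valued.v (R := PadicAlgCl p)).valuationSubring) (fun j : {v : IsDedekindDomain.HeightOneSpectrum (NumberField.RingOfIntegers K) // v ∉ S} × Fin 2 => Literature.NumberTheory.Automorphic.GLn.sndHom 2 K (Literature.NumberTheory.Automorphic.heckeDiagAt 2 K j.1.1 (ϖ j.1.1) (j.2.val + 1))) (fun j => a j.1 (j.2.val + 1)) ∧ ∀ (v : IsDedekindDomain.HeightOneSpectrum (NumberField.RingOfIntegers K)) (hv : v ∉ S), σ.IsHeckeAssociatedAt v (fun i : ℕ => if i = 0 then (1 : PadicAlgCl p) else ((a ⟨v, hv⟩ i : (Valued.v (R := PadicAlgCl p)).valuationSubring) : PadicAlgCl p))) → ∃ (hcpt : Literature.NumberTheory.Automorphic.isCompact_glFiniteIntegralLevel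 2 K) (π : Literature.NumberTheory.Automorphic.CuspidalAutomorphicRepData 2 K hcpt), ∀ᶠ w : IsDedekindDomain.HeightOneSpectrum (NumberField.RingOfIntegers K) in Filter.cofinite, SatakeFrobCompatibleAt ι π.1 σ w

/-- item stmt-Langlands-19093 · crux · rank 7 · open · by planner
why it might fail: Formalization debt, not mathematics (JS II Prop. 3.6 is a theorem): false AS TYPED only by a normalisation slip in the inlined text (q_w^(1−s₀) vs q_w^(s₀−1), unitary normalisation, α vs β⁻¹); ranks ≤ 2 of this exact text are proved in tree (…_pole_repData_rank_of_le_two).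
sources: JacquetShalikaAJM1981II, ArthurClozelAMS120, JacquetShalikaAJM1981, ShahidiAJM1981, HumphriesJo2024, CogdellAnalyticTheory2004
[crux] ARTHUR–CLOZEL (2.3) FOR BOREL–JACQUET DATA — PROMOTED LITERATURE INPUT of the junction's line
(route-choice 2026-08-17, unit rchoice-Summits-Langlands-Langlands-Cr-16a26670: the birth skeleton
Cruxes/SectorComplement/Lines/birth.lean of SectorComplement (stmt-Langlands-14623) consumed the
named fact Literature.NumberTheory.Automorphic.JacquetShalika1981_partialPairL_pole_repData as its
stub stub_pairLPoleJS; that fact is judged XL-apex — too large for one prover seat, and non-crux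
Literature facts are not split — so it is promoted to an explicit crux of this route and the line is
rewired to this decl BY NAME). STATEMENT (Jacquet–Shalika II Prop. 3.6 = Arthur–Clozel Ch. 3 §2
(2.3), p. 171, in the Borel–Jacquet model): for cuspidal π, π′ on GL_n(𝔸_F) (n ≥ 1, data
CuspidalAutomorphicRepData, arbitrary central characters) there is a finite S₀ such that for every
finite S ⊇ S₀, all Satake families α, β of π, π′ off S in unitary normalisation (‖∏α_w‖ = ‖∏β_w‖ =
1) and every s₀ on Re s = 1 IN X (q_w^(1−s₀)·α_w = β_w⁻¹ as multisets for almost all w: the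
Hecke-matrix form of π ⊗ |·|^(s₀−1) ≅ σ̃), the limit of (s − s₀)·L^S(s, α × β) as s → s₀ with Re s >
1 exists and is NON-ZERO, wher -/
@[route_item "route-Langlands-RuelleTorsionArtinWeight"]
def PairLPoleJS : Prop :=
  ∀ (n : ℕ) (F : Type) [Field F] [NumberField F] (hF : Literature.NumberTheory.Automorphic.isCompact_glFiniteIntegralLevel n F), 0 < n → ∀ (π π' : Literature.NumberTheory.Automorphic.CuspidalAutomorphicRepData n F hF), ∃ S₀ : Set (IsDedekindDomain.HeightOneSpectrum (NumberField.RingOfIntegers F)), S₀.Finite ∧ ∀ {S : Set (IsDedekindDomain.HeightOneSpectrum (NumberField.RingOfIntegers F))}, S.Finite → S₀ ⊆ S → ∀ {α β : IsDedekindDomain.HeightOneSpectrum (NumberField.RingOfIntegers F) → Multiset ℂ}, (∀ w ∉ S, π.1.HasSatakeParamAt w (α w)) → (∀ w ∉ S, π'.1.HasSatakeParamAt w (β w)) → (∀ w ∉ S, ‖(α w).prod‖ = 1) → (∀ w ∉ S, ‖(β w).prod‖ = 1) → ∀ {s₀ : ℂ}, s₀.re = 1 → (∀ᶠ w in cofinite,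 (α w).map ((((w.residueCard : ℂ) ^ (1 - s₀))) * ·) = (β w).map (·⁻¹)) → ∃ c : ℂ, c ≠ 0 ∧ Tendsto (fun s : ℂ => (s - s₀) * ∏' w : {w : IsDedekindDomain.HeightOneSpectrum (NumberField.RingOfIntegers F) // w ∉ S}, ((Literature.NumberTheory.Automorphic.satakePairPolynomial (α w.1) (β w.1)).eval ((w.1.residueCard : ℂ) ^ (-s)))⁻¹) (𝓝[{s : ℂ | 1 < s.re}] s₀) (𝓝 c)

/-- item stmt-Langlands-13622 · crux · rank 8 · open · by planner
why it might fail: Formalization debt, not mathematics (JS II Prop. 3.6 off X + Shahidi non-vanishing): false AS TYPED only by a normalisation slip in the inlined text (q_w^(1−s₀) vs q_w^(s₀−1), unitary normalisation, X-condition n = m ∧ α·q^(1−s₀) = β⁻¹ a.e.).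
sources: JacquetShalikaAJM1981II, ArthurClozelAMS120, JacquetShalikaAJM1981, ShahidiAJM1981
[support] INPUT — Jacquet–Shalika 1981 / Arthur–Clozel Ch. 3 (2.2) for cuspidal Borel–Jacquet data
on GL_n × GL_m: off the X-condition (n = m and, a.e., β_w⁻¹ = q_w^{1−s₀}·α_w as multisets), assuming
unitary central characters a.e. (‖∏ α_w‖ = ‖∏ β_w‖ = 1), the partial Rankin–Selberg product L^S(s, α
× β) = ∏'_{w ∉ S} ∏_{a,b} (1 − a b q_w^{−s})⁻¹ has a finite NON-ZERO limit at Re s₀ = 1 from Re s >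
1. SAME TEXT as
`Literature.NumberTheory.Automorphic.JacquetShalika1981_partialPairL_boundary_repData` with
`partialPairL S α β` unfolded to its defining `tprod` over `satakePairPolynomial`
(RankinSelbergLocal, in the Statement's closure) and `SatakeFamily F` unfolded to `HeightOneSpectrum
(𝓞 F) → Multiset ℂ` — definitionally equal (delta/eta), closes by `exact`/`simpa [partialPairL]` the
day the fact's `_holds` lands (it is reduced in tree to its L² leaves). CONE REPAIR 2026-08-15
(route-repair planner): no import of PairLFunctionPolesRepData (whose closure carried 383 modules /
~45 unproved facts into the cone). Rank 1 (renders before IrreducibleGL3CM). [difficulty: L] -/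
@[route_item "route-Langlands-RuelleTorsionArtinWeight"]
def PairLBoundaryJS : Prop :=
  ∀ (n m : ℕ) (F : Type) [Field F] [NumberField F] (hF : _) (hF' : _), 0 < n → 0 < m → ∀ (π : Literature.NumberTheory.Automorphic.CuspidalAutomorphicRepData n F hF) (π' : Literature.NumberTheory.Automorphic.CuspidalAutomorphicRepData m F hF'), ∃ S₀ : Set (IsDedekindDomain.HeightOneSpectrum (NumberField.RingOfIntegers F)), S₀.Finite ∧ ∀ {S : Set (IsDedekindDomain.HeightOneSpectrum (NumberField.RingOfIntegers F))}, S.Finite → S₀ ⊆ S → ∀ {α β : IsDedekindDomain.HeightOneSpectrum (NumberField.RingOfIntegers F) → Multiset ℂ}, (∀ w ∉ S, π.1.HasSatakeParamAt w (α w)) → (∀ w ∉ S, π'.1.HasSatakeParamAt w (β w)) → (∀ w ∉ S, ‖(α w).prod‖ = 1) → (∀ w ∉ S, ‖(β w).prod‖ = 1) → ∀ {s₀ : ℂ}, s₀.re = 1 → ¬ (n = m ∧ ∀ᶠ w in cofinite, (α w).map ((((w.residueCard : ℂ) ^ (1 - s₀))) * ·) = (β w).map (·⁻¹)) → ∃ c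 : ℂ, c ≠ 0 ∧ Tendsto (fun s : ℂ => ∏' w : {w : IsDedekindDomain.HeightOneSpectrum (NumberField.RingOfIntegers F) // w ∉ S}, ((Literature.NumberTheory.Automorphic.satakePairPolynomial (α w.1) (β w.1)).eval ((w.1.residueCard : ℂ) ^ (-s)))⁻¹) (𝓝[{s : ℂ | 1 < s.re}] s₀) (𝓝 c)

/-- item stmt-Langlands-16812 · crux · rank 8 · open · by planner
why it might fail: Theorem in print (Langlands 1980; A–C III.4.2(a)+5.1; (a) also by Jacquet 1972 converse thm / theta lift), XL to formalise; as typed only drift can bite: the inert witness α ≠ −α must force π ≇ π ⊗ η (it does); (b)–(d) assert strong lifting for ANY cuspidal weak lift P (= BC(π) by SMO).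
sources: LanglandsBaseChange1980, ArthurClozelAMS120 Ch. 3 Thm 4.2 (a), Thm 5.1, Ch. 1 §6–7, Jacquet1972 Thm 20.6, Gelbart1997 §6, Friedberg1983, p123485
[crux] (PROMOTED rev 10, route-choice a6bd8d4f: the harness judged baseChange_cyclic_cuspidal
XL-apex — it reduces only to its L² twin ArthurClozel1989_weakLifting_cuspidal, the trace-formula
comparison for all n) Quadratic BASE CHANGE for GL₂, F a number field, E/F Galois with [E:F] = 2,
four clauses = the n = 2 specialisations of the tree facts: (a) baseChange_cyclic_cuspidal (A–C
III.4.2 (a)): a cuspidal π on GL₂(𝔸_F) with a Satake parameter α ≠ −α (as multisets) at ONE place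
inert in E has, for every hE, a CUSPIDAL weak lift P on GL₂(𝔸_E); (b)
ArthurClozel1989_strongLifting_unramified (III.5.1 + I §6): a cuspidal weak lift is an unramified
strong lift (IsUnramifiedBaseChangeLift) and unramifiedness descends at places unramified in E; (c)
…_allFinite: t_{P,w} = t_{π,v}^{f(w|v)} at EVERY finite w over v with π_v unramified, v ramified in
E allowed; (d) …_archimedean (III.5.1 + I §7): archimedean parameters restrict, χ_P(τ) = χ_π(τ|_F).
Each clause is implied verbatim by its tree fact at (2, F, E). Consumed by
ResidualBianchiDoorLevelBC ((a),(c),(d) at (ℚ, K): BC_K(π_f) cuspidal, regular algebraic, congruent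
at every good place incl. those ramified in K/ℚ) and IcosahedralDescentLe -/
@[route_item "route-Langlands-RuelleTorsionArtinWeight"]
def QuadraticBaseChangeGL2 : Prop :=
  (∀ (F E : Type) [Field F] [NumberField F] [Field E] [NumberField E] [Algebra F E] [IsGalois F E], Module.finrank F E = 2 → ∀ (hF : Literature.NumberTheory.Automorphic.isCompact_glFiniteIntegralLevel 2 F) (π : Literature.NumberTheory.Automorphic.CuspidalAutomorphicRepData 2 F hF), (∃ (v : IsDedekindDomain.HeightOneSpectrum (NumberField.RingOfIntegers F)) (w : IsDedekindDomain.HeightOneSpectrum (NumberField.RingOfIntegers E)) (α : Multiset ℂ), w.asIdeal.under (NumberField.RingOfIntegers F) = v.asIdeal ∧ w.asIdeal.inertiaDeg (NumberField.RingOfIntegers F) = Module.finrank F E ∧ π.1.HasSatakeParamAt v α ∧ ∀ ζ : ℂ, IsPrimitiveRoot ζ (Module.finrank F E) → α.map (ζ * ·) ≠ α) → ∀ (hE : Literature.NumberTheory.Automorphic.isCompact_glFiniteIntegralLevel 2 E), ∃ P : Literature.NumberTheory.Automorphic.CuspidalAutomorphicRepData 2 E hE, Literature.NumberTheory.Automorphic.IsWeakBaseChangeLiftAE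 π.1 P.1) ∧ (∀ (F E : Type) [Field F] [NumberField F] [Field E] [NumberField E] [Algebra F E] [IsGalois F E], Module.finrank F E = 2 → ∀ (hF : Literature.NumberTheory.Automorphic.isCompact_glFiniteIntegralLevel 2 F) (hE : Literature.NumberTheory.Automorphic.isCompact_glFiniteIntegralLevel 2 E) (π : Literature.NumberTheory.Automorphic.CuspidalAutomorphicRepData 2 F hF) (P : Literature.NumberTheory.Automorphic.CuspidalAutomorphicRepData 2 E hE), Literature.NumberTheory.Automorphic.IsWeakBaseChangeLiftAE π.1 P.1 → Literature.NumberTheory.Automorphic.IsUnramifiedBaseChangeLift π.1 P.1 ∧ ∀ v : IsDedekindDomain.HeightOneSpectrum (NumberField.RingOfIntegers F), Algebra.IsUnramifiedIn (NumberField.RingOfIntegers E) v.asIdeal → (∀ w : IsDedekindDomain.HeightOneSpectrum (NumberField.RingOfIntegers E), w.asIdeal.under (NumberField.RingOfIntegers F) = v.asIdeal → P.1.IsUnramifiedAt w) → π.1.IsUnramifiedAt v) ∧ (∀ (F E : Type) [Field F] [NumberField F] [Field E] [NumberField E] [Algebra F E] [IsGalois F E], Module.finrank F E = 2 → ∀ (hF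 : Literature.NumberTheory.Automorphic.isCompact_glFiniteIntegralLevel 2 F) (hE : Literature.NumberTheory.Automorphic.isCompact_glFiniteIntegralLevel 2 E) (π : Literature.NumberTheory.Automorphic.CuspidalAutomorphicRepData 2 F hF) (P : Literature.NumberTheory.Automorphic.CuspidalAutomorphicRepData 2 E hE), Literature.NumberTheory.Automorphic.IsWeakBaseChangeLiftAE π.1 P.1 → ∀ (w : IsDedekindDomain.HeightOneSpectrum (NumberField.RingOfIntegers E)) (v : IsDedekindDomain.HeightOneSpectrum (NumberField.RingOfIntegers F)) (α : Multiset ℂ), w.asIdeal.under (NumberField.RingOfIntegers F) = v.asIdeal → π.1.HasSatakeParamAt v α → P.1.HasSatakeParamAt w (α.map (· ^ w.asIdeal.inertiaDeg (NumberField.RingOfIntegers F)))) ∧ (∀ (F E : Type) [Field F] [NumberField F] [Field E] [NumberField E] [Algebra F E] [IsGalois F E], Module.finrank F E = 2 → ∀ (hF : Literature.NumberTheory.Automorphic.isCompact_glFiniteIntegralLevel 2 F) (hE : Literature.NumberTheory.Automorphic.isCompact_glFiniteIntegralLevel 2 E) (π : Literature.NumberTheory.Automorphic.CuspidalAutomorphicRepData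 2 F hF) (P : Literature.NumberTheory.Automorphic.CuspidalAutomorphicRepData 2 E hE), Literature.NumberTheory.Automorphic.IsWeakBaseChangeLiftAE π.1 P.1 → ∀ χ : (F →+* ℂ) → Multiset ℂ, π.1.HasArchParameter χ → P.1.HasArchParameter fun τ => χ (τ.comp (algebraMap F E)))

/-- item stmt-Langlands-10839 · crux (kind.auto-crux: conjecture-grade) · rank 9 · open · by planner
why it might fail: auto-crux — summit-strength (notes:refuter-refute-pool-g43-1): the deciding theorem assumes it and nothing in the route derives it, so it is a bet, not glue
sources: BuzzardGeeLMS2014, FontaineMazurGeometric1995, ArthurClozelAMS120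
[support] the rest of the summit: the GL₂ Artin sector over imaginary quadratic fields (a.e. form) ⇒
Langlands (upgrade a.e. to Corresponds by LGC + strong multiplicity one; quadratic descent K → ℚ for
even ρ; all other n, F, weights and direction (A)). Not this route's business; filed so that closes
ends in the summit constant; shared junction for every imaginary-quadratic Artin card. [difficulty:
open-problem] -/
@[route_item "route-Langlands-RuelleTorsionArtinWeight", crux]
def ImQuadArtinJunction : Prop :=
  StrongArtinImQuad → _root_.Langlands

-- item stmt-Langlands-10857 · support · rank 5 · open · by planner — informal only, no Lean statement yet:
--   [crux] (card K2, the Artin excess, in single-degree torsion form; layer 2 under ArtinPointsBianchi;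
--   informal until the definition request IntegralWeightHeckeModuleGL2 lands) K imaginary quadratic; p ≥
--   5 split in K; σ : Γ_K → GL₂(ℚ̄_p) irreducible with finite image, unramified above p with distinct
--   Frobenius eigenvalues at both v ∣ p, p ∤ #im σ (so σ̄ is absolutely irreducible and 𝔪_σ̄ is
--   non-Eisenstein); 𝔫 = prime-to-p Artin conductor of σ; Γ = Γ₀(𝔫) ∩ Γ₁(p) ≤ GL₂(O_K) (or the norm-one
--   units of an Eichler order of level 𝔫p in a division quaternion algebra B/K, the
--   torsion-Jacquet–Langlands par

-- item stmt-Langlands-10855 · support · rank 6 · open · by planner — informal only, no Lean statement yet: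
--   [crux] (card K2, the dictionary "λ-invariant = weight-λ_* points", read in the direction the
--   assembly needs; layer 2 under ArtinPointsBianchi; informal until IntegralWeightHeckeModuleGL2 lands)
--   Setting of ArtinTorsionExcess with an arbitrary non-Eisenstein maximal ideal 𝔪 of the Hecke algebra
--   of tame level 𝔫 and an arbitrary limit weight λ_* = (a, a') approached along λ_m = (a + b p^m, a' +
--   b' p^m), (a,b) ≠ (a',b'). CLAIM: if the p-exponent of H₁(Γ, V_{λ_m})_𝔪 is unbounded in m, then the
--   𝔪-localised big Hecke algebra 𝕋(K^p)_𝔪 of the completed cohomology of the Bianchi tower of tame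
--   level 𝔫 (tr

/-- item stmt-Langlands-10840 · assembly · rank 1 · open · by planner
sources: BuzzardGeeLMS2014
[assembly] ArtinPointsBianchi → ArtinWeightRealisation → ImQuadArtinJunction → Langlands. -/
@[route_item "route-Langlands-RuelleTorsionArtinWeight"]
def Assembly : Prop :=
  ArtinPointsBianchi → ArtinWeightRealisation → ImQuadArtinJunction → _root_.Langlands

/-! D-0027 §2.1 — DECIDING THEOREM (planner-authored via `route open/edit --closes-file`; by planner-rrepair-Langlands-RuelleTorsionArtinWe-be271b09-0 2026-08-15T16:46:17Z):
its hypotheses are this route's items and its conclusion the sub-problem Statement (glue_lint), and it elaborates with this file. -/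

@[closes "route-Langlands-RuelleTorsionArtinWeight"] theorem closes (hocc : ArtinPointsBianchi) (hcls : ArtinWeightRealisation) (hJ : ImQuadArtinJunction) :
    _root_.Langlands :=
  hJ (fun K _ _ hK hK2 p _ ι σ hfin hirr => hcls K hK hK2 p ι σ hfin hirr (hocc K hK hK2 p σ hfin hirr))

end Summit.Langlands.Langlands.Theses.RuelleTorsionArtinWeight
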